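import Summits.CriticalPhenomena.SAWScalingLimit.Theses.SAWRestrictionRigidity
import Summits.CriticalPhenomena.CardyFormulaZ2.Theorems.CardyAnchoredRigidityAnchoredPullbackAxioms
import Literature.Probability.RandomPlanarGeometry.FreelyJointedSAWCovariance
import HarnessLib

/-!
# Stub `stub_transportAxioms` of line `registered` (crux `Rigidity`, stmt-CriticalPhenomena-1368,
# route SAWRestrictionRigidity): transporting a chordal family along a linear automorphism

Bookkeeping split off the conjectural core `stub_linearModulusCore` by the lead: if
`S D = (L⁻¹)_* (P (L D))` for a real-linear automorphism `L` of the plane (indeed for any plane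
homeomorphism), then `S` inherits from `P` chordality (`ChordalFamily.IsChordal`), the two-sided
restriction property (`ChordalFamily.IsRestriction`) and "carried by simple curves meeting `∂D` only
at the marked points". Transport of structure: `CurveClass.map φ⁻¹` is a measurable embedding of
curve space (`AnchoredPullback.measurableEmbedding_map`), so image laws are computed on preimages
of ALL sets and a.e. statements transport (`MeasurableEmbedding.map_apply / ae_map_iff`); ranges,
closures and frontiers are transported by `φ`; simplicity of classes is invariant under
homeomorphisms (`FreelyJointedSAW.map_mem_simple_iff`). The chordality step is the tree's
`AnchoredPullback.isChordal_step` verbatim.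

References: V. Beffara, *Is critical 2D percolation universal?* (2008), Prop. 4 (linear images
of a scaling limit) [Beffara2008Universal]; G. F. Lawler, O. Schramm, W. Werner, *Conformal
restriction: the chordal case* (2003), §3 [LawlerSchrammWerner2003Restriction].
-/

noncomputable section

namespace Summit.CriticalPhenomena.SAWScalingLimit.Cruxes.Rigidity.Birth

open Set MeasureTheory
open Literature.Probability.RandomPlanarGeometry
open Summit.CriticalPhenomena.CardyFormulaZ2.Theorems.AnchoredPullback
  (isChordal_step measurableEmbedding_map)

/-- Pulling the event "the curve stays in `closure D'`" back along `CurveClass.map φ⁻¹` gives the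
event "the curve stays in `closure (φ D')`" (ranges, closures are transported by `φ`). [folklore] -/
theorem preimage_map_symm_rangeSubset (φ : ℂ ≃ₜ ℂ) (A : Set ℂ) :
    CurveClass.map (φ.symm : C(ℂ, ℂ)) ⁻¹' CurveClass.rangeSubset (closure A) =
      CurveClass.rangeSubset (closure (φ '' A)) := by
  ext c
  simp only [mem_preimage, CurveClass.mem_rangeSubset, CurveClass.range_map,
    ContinuousMap.coe_coe, Set.image_subset_iff, Homeomorph.preimage_symm, Homeomorph.image_closure]

/-- **Restriction transports** along a plane homeomorphism, one domain pair at a time: the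
restriction identity of `P` between `φ D' ⊆ φ D` becomes that of `φ⁻¹_* P (φ ·)` between
`D' ⊆ D` (image laws on preimages of all sets, `MeasurableEmbedding.map_apply`). [folklore] -/
theorem isRestriction_step {P : ChordalFamily} (hP : P.IsRestriction) (φ : ℂ ≃ₜ ℂ)
    {D D' : DobrushinDomain} (hsub : D'.carrier ⊆ D.carrier) (h0 : D'.pt 0 = D.pt 0)
    (h1 : D'.pt 1 = D.pt 1) {T : Set (CurveClass ℂ)} (hT : MeasurableSet T) :
    (P (D'.map φ)).map (CurveClass.map (φ.symm : C(ℂ, ℂ))) T *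
        (P (D.map φ)).map (CurveClass.map (φ.symm : C(ℂ, ℂ)))
          (CurveClass.rangeSubset (closure D'.carrier)) =
      (P (D.map φ)).map (CurveClass.map (φ.symm : C(ℂ, ℂ)))
        (T ∩ CurveClass.rangeSubset (closure D'.carrier)) := by
  have he := measurableEmbedding_map φ.symm
  rw [he.map_apply, he.map_apply, he.map_apply, Set.preimage_inter,
    preimage_map_symm_rangeSubset]
  exact hP (D.map φ) (D'.map φ) (image_mono hsub)
    (by rw [MarkedDomain.pt_map, MarkedDomain.pt_map, h0])
    (by rw [MarkedDomain.pt_map, MarkedDomain.pt_map, h1]) _ (he.measurable hT)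

/-- **Simplicity and boundary avoidance transport** along a plane homeomorphism: if `P (φ D)` is
carried by simple curves meeting `∂(φ D)` only at `φ a, φ b`, then `φ⁻¹_* P (φ D)` is carried by
simple curves meeting `∂D` only at `a, b` (simplicity is invariant under homeomorphisms,
frontiers are transported, `φ` is injective). [folklore] -/
theorem simple_step {P : ChordalFamily}
    (hP : ∀ D : DobrushinDomain, ∀ᵐ γ ∂(P D),
      γ ∈ CurveClass.simple ∧ γ.range ∩ frontier D.carrier ⊆ {D.pt 0, D.pt 1})
    (φ : ℂ ≃ₜ ℂ) (D : DobrushinDomain) :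
    ∀ᵐ γ ∂((P (D.map φ)).map (CurveClass.map (φ.symm : C(ℂ, ℂ)))),
      γ ∈ CurveClass.simple ∧ γ.range ∩ frontier D.carrier ⊆ {D.pt 0, D.pt 1} := by
  rw [(measurableEmbedding_map φ.symm).ae_map_iff]
  filter_upwards [hP (D.map φ)] with γ hγ
  obtain ⟨hs, hfr⟩ := hγ
  refine ⟨(FreelyJointedSAW.map_mem_simple_iff (f := (φ.symm : C(ℂ, ℂ))) (g := (φ : C(ℂ, ℂ)))
    (fun x => φ.apply_symm_apply x)).2 hs, ?_⟩
  rw [CurveClass.range_map, ContinuousMap.coe_coe]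
  rintro _ ⟨⟨y, hy, rfl⟩, hzf⟩
  have hy' : y ∈ γ.range ∩ frontier (D.map φ).carrier := by
    refine ⟨hy, ?_⟩
    rw [MarkedDomain.carrier_map, ← φ.image_frontier]
    exact ⟨φ.symm y, hzf, φ.apply_symm_apply y⟩
  have hmem := hfr hy'
  simp only [MarkedDomain.pt_map, mem_insert_iff, mem_singleton_iff] at hmem
  rcases hmem with rfl | rfl
  · exact Or.inl (φ.symm_apply_apply _)
  · exact Or.inr (φ.symm_apply_apply _)

/-- Registered stub `stub_transportAxioms` (line `registered`, crux stmt-CriticalPhenomena-1368):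
transporting a chordal family along a real-linear automorphism `L` of the plane,
`S D = (L⁻¹)_* (P (L D))`, preserves chordality, the two-sided restriction property and "carried by
simple boundary-avoiding curves". [folklore] -/
theorem stub_transportAxioms : ∀ (P S : Literature.Probability.RandomPlanarGeometry.ChordalFamily) (L : ℂ ≃L[ℝ] ℂ), (∀ D : Literature.Probability.RandomPlanarGeometry.DobrushinDomain, S D = (P (D.map L.toHomeomorph)).map (Literature.Probability.RandomPlanarGeometry.CurveClass.map (L.symm.toHomeomorph : C(ℂ, ℂ)))) → P.IsChordal → P.IsRestriction → (∀ D : Literature.Probability.RandomPlanarGeometry.DobrushinDomain, ∀ᵐ γ ∂(P D), γ ∈ Literature.Probability.RandomPlanarGeometry.CurveClass.simple ∧ γ.range ∩ frontier D.carrier ⊆ {D.pt 0, D.pt 1}) → S.IsChordal ∧ S.IsRestriction ∧ (∀ D : Literature.Probability.RandomPlanarGeometry.DobrushinDomain, ∀ᵐ γ ∂(S D), γ ∈ Literature.Probability.RandomPlanarGeometry.CurveClass.simple ∧ γ.range ∩ frontier D.carrier ⊆ {D.pt 0, D.pt 1}) := by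
  intro P S L hS hch hres hsimple
  have hS' : ∀ D : DobrushinDomain, S D = (P (D.map L.toHomeomorph)).map
      (CurveClass.map ((L.toHomeomorph).symm : C(ℂ, ℂ))) := hS
  refine ⟨fun D => ?_, ?_, fun D => ?_⟩
  · rw [hS' D]
    exact isChordal_step hch L.toHomeomorph D
  · intro D D' hsub h0 h1 T hT
    rw [hS' D, hS' D']
    exact isRestriction_step hres L.toHomeomorph hsub h0 h1 hT
  · rw [hS' D]
    exact simple_step hsimple L.toHomeomorph D

end Summit.CriticalPhenomena.SAWScalingLimit.Cruxes.Rigidity.Birth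

end
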